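import Literature.Algebra.Homology.OrderedCechSystemAlternating
import Mathlib.AlgebraicTopology.AlternatingFaceMapComplex
import HarnessLib

/-!
# The FULL (cosimplicial) Čech complex of a system of modules, its position cup product, pull-backs along arbitrary
# index maps, and the restriction to ∕ extension from the ordered complex — DEFINITIONS
# (The Stacks Project, Tags 01FG, 01FP; Godement II §5.8, §6.6; Serre FAC n° 20)

Layer `Algebra/Homology` (pure algebra; DEF lane: definitions + unfolding lemmas).  Cell `hodgecm-mathlib` FLOOR 0, P1 sub-line
F-11, packet (iv)∕J3, brick **F-F** (F0P1b-plan (g0) RULINGS #3 (R14), dialect «D-full-lite»; F0P1b-p01 (g0)).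

For a system `M : Finset ι ⥤ ModuleCat A` on a linearly ordered index set the ORDERED Čech complex ★ `OrderedCech.sysComplex M`
has one component per strictly increasing tuple.  The FULL Čech complex has one component per ARBITRARY tuple
`α : Fin (n+1) → ι` with value in `M {α}` ([StacksProject, Tag 01FG]: `Čᵖ(𝓤, 𝓕) = Π_{(i₀,…,i_p) ∈ I^{p+1}} 𝓕(U_{i₀…i_p})`); it is
the alternating coface map complex of the COSIMPLICIAL module `[n] ↦ Π_α M {α}` (Mathlib `AlternatingCofaceMapComplex`), so
`d ∘ d = 0` and functoriality come for free, and — the point of the «D-full-lite» design — it carries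

* a cup product BY POSITION `(x ∪ y)(α₀…α_{p+q}) = β(x(α₀…α_p)|, y(α_p…α_{p+q})|)` needing NO order on `ι` (`OrderedCech.Full.cup`);
* pull-backs `Θ_θ` along an ARBITRARY map of index sets `θ : ι' → ι` (precomposition; a morphism of cosimplicial objects, hence a
  cochain map, and multiplicative ON COCHAINS) (`OrderedCech.Full.pullback`);
* for the given linear order, the restriction `res : F → Č_ord` (keep the strictly increasing tuples) and the alternating extension
  `ext : Č_ord → F`, `(ext g)(α) = g.altEvalAt α {α}` (★-in-HOME core-1 `OrderedCechSystemAlternating`).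

The theorems (`res`, `ext` are cochain maps, `res ∘ ext = 𝟙`, Leibniz for `∪`, `res` and `Θ` multiplicative) are the PROOF-lane sequel
`OrderedCechSystemFullRing`; the geometric consequence «`H(res)` is an isomorphism» (so that `θ^* := H(res' ∘ Θ_θ ∘ ext)` is multiplicative
for every `θ`) is `AlgebraicGeometry/Modules/CechFullToOrdered`.  No instance, no notation, no named fact, no `sorry`.

## References
* The Stacks Project, Tag 01FG (Čech complex, alternating and ordered variants), Tag 01FP (cup product). [StacksProject]
* R. Godement, *Topologie algébrique et théorie des faisceaux* (1958), II §5.8, §6.6. [folklore]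
* U. Görtz, T. Wedhorn, *Algebraic Geometry II* (2023), Def. 21.64, Def. 21.68, (21.29) (pp. 179–181). [GortzWedhorn2023]
-/

universe v u

open CategoryTheory

set_option backward.isDefEq.respectTransparency false -- `ModuleCat`-valued functors (as in ★ `OrderedCechSystem`)

noncomputable section

namespace Literature.Algebra.Homology

namespace OrderedCech

namespace Full

variable {ι : Type} [LinearOrder ι] {A : Type u} [CommRing A] (M : Finset ι ⥤ ModuleCat.{v} A)

/-! ## §1 The cosimplicial module of full cochains and its alternating coface map complex -/

/-- The full `n`-cochains of a system: `Π_{α : Fin (n+1) → ι} M {α}` — one component for EVERY tuple (an `abbrev`, so the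
pointwise `AddCommGroup` ∕ `Module A` structures are the `Pi` ones). [cite: StacksProject, Tag 01FG] -/
abbrev Cochain (n : ℕ) : Type v := ∀ α : Fin (n + 1) → ι, M.obj (Finset.univ.image α)

variable {M} in
/-- Reindexing a tuple along a map of positions shrinks its image (the index bookkeeping behind the
Čech cosimplicial structure). [cite: StacksProject, Tag 01FG] -/
theorem image_comp_subset {m n : ℕ} (α : Fin (n + 1) → ι) (f : Fin (m + 1) → Fin (n + 1)) :
    Finset.univ.image (α ∘ f) ⊆ Finset.univ.image α := by
  intro x hx
  obtain ⟨i, -, rfl⟩ := Finset.mem_image.mp hx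
  exact Finset.mem_image.mpr ⟨f i, Finset.mem_univ _, rfl⟩

/-- The cosimplicial structure map along `f : [m] → [n]`: `(f_* c)(α) = c(α ∘ f)|_{ {α} }`, as a linear map.
[cite: StacksProject, Tag 01FG] -/
def cosimplicialMap {m n : ℕ} (f : Fin (m + 1) →o Fin (n + 1)) : Cochain M m →ₗ[A] Cochain M n where
  toFun c α := (M.map (homOfLE (image_comp_subset α f))).hom (c (α ∘ f))
  map_add' c c' := by funext α; exact map_add _ _ _
  map_smul' a c := by funext α; exact map_smul _ _ _

/-- Components of the structure map. [cite: StacksProject, Tag 01FG] -/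
@[simp] theorem cosimplicialMap_apply {m n : ℕ} (f : Fin (m + 1) →o Fin (n + 1)) (c : Cochain M m)
    (α : Fin (n + 1) → ι) : cosimplicialMap M f c α = (M.map (homOfLE (image_comp_subset α f))).hom (c (α ∘ f)) := rfl

/-- Transport of a component along an equality of tuples is the restriction along the induced inclusion.
[cite: StacksProject, Tag 01FG] -/
theorem map_congr_apply {n : ℕ} (c : Cochain M n) {α α' : Fin (n + 1) → ι} (h : α = α') :
    (M.map (homOfLE (h ▸ subset_rfl : Finset.univ.image α ⊆ Finset.univ.image α'))).hom (c α) = c α' := by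
  subst h
  have : homOfLE (subset_rfl : Finset.univ.image α ⊆ Finset.univ.image α) = 𝟙 _ := rfl
  rw [this, M.map_id]
  rfl

/-- **The cosimplicial `A`-module of full cochains** `[n] ↦ Π_{α : Fin (n+1) → ι} M {α}`.
[cite: StacksProject, Tag 01FG] -/
def cosimplicial : CosimplicialObject (ModuleCat.{v} A) where
  obj Δ := ModuleCat.of A (Cochain M Δ.len)
  map f := ModuleCat.ofHom (cosimplicialMap M f.toOrderHom)
  map_id Δ := by
    ext c α
    change (M.map (homOfLE _)).hom (c (α ∘ ⇑(SimplexCategory.Hom.toOrderHom (𝟙 Δ)))) = c α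
    exact map_congr_apply M c rfl
  map_comp {Δ₁ Δ₂ Δ₃} f g := by
    ext c α
    change (M.map (homOfLE _)).hom (c (α ∘ ⇑(SimplexCategory.Hom.toOrderHom (f ≫ g)))) =
      (M.map (homOfLE _)).hom ((M.map (homOfLE _)).hom (c ((α ∘ ⇑g.toOrderHom) ∘ ⇑f.toOrderHom)))
    rw [← ModuleCat.comp_apply, ← M.map_comp]
    rfl

/-- **The full Čech complex of a system** (alternating coface map complex; `d = Σ_j (-1)^j δ_j`, `d ∘ d = 0` from Mathlib).
[cite: StacksProject, Tag 01FG] -/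
def complex : CochainComplex (ModuleCat.{v} A) ℕ :=
  AlgebraicTopology.AlternatingCofaceMapComplex.obj (cosimplicial M)

/-- The terms of the full complex are the full cochains. [cite: StacksProject, Tag 01FG] -/
theorem complex_X (n : ℕ) : (complex M).X n = ModuleCat.of A (Cochain M n) := rfl

/-- **The differential of the full complex**: `(d c)(β) = Σ_j (-1)^j · c(β ∘ δ_j)|_{ {β} }`.
[cite: StacksProject, Tag 01FG] [cite: GortzWedhorn2023, Def. 21.64 (p. 179)] -/
theorem complex_d_apply (n : ℕ) (c : Cochain M n) (β : Fin (n + 2) → ι) :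
    ((complex M).d n (n + 1)).hom c β =
      ∑ j : Fin (n + 2), (-1 : ℤ) ^ (j : ℕ) •
        (M.map (homOfLE (image_comp_subset β (Fin.succAbove j)))).hom (c (β ∘ Fin.succAbove j)) := by
  have hd : (complex M).d n (n + 1) = AlgebraicTopology.AlternatingCofaceMapComplex.objD (cosimplicial M) n :=
    CochainComplex.of_d (V := ModuleCat.{v} A) (fun n => (cosimplicial M).obj (SimplexCategory.mk n))
      (AlgebraicTopology.AlternatingCofaceMapComplex.objD (cosimplicial M)) n
  rw [hd, AlgebraicTopology.AlternatingCofaceMapComplex.objD]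
  rw [ModuleCat.hom_sum, LinearMap.sum_apply, Finset.sum_apply]
  refine Finset.sum_congr rfl fun j _ => ?_
  rw [ModuleCat.hom_zsmul, LinearMap.smul_apply, Pi.smul_apply]
  rfl

/-! ## §2 Pull-back along an arbitrary map of index sets -/

section Pullback

variable {M} {ι' : Type} [LinearOrder ι'] {M' : Finset ι' ⥤ ModuleCat.{v} A} (θ : ι' → ι)
  (φ : imageFunctor θ ⋙ M ⟶ M')

/-- The image of a `θ`-reindexed tuple (refinement bookkeeping). [cite: StacksProject, Tag 01FG] -/
theorem image_comp_eq {n : ℕ} (α' : Fin (n + 1) → ι') :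
    Finset.univ.image (θ ∘ α') = (Finset.univ.image α').image θ := by
  rw [Finset.image_image]

/-- **Pull-back of full cochains along an ARBITRARY map of index sets** `θ : ι' → ι` (with the restriction datum
`φ_{s'} : M(θ s') → M'(s')`): `(Θ c)(α') = φ (c(θ ∘ α'))`. [cite: StacksProject, Tag 01FG] -/
def pullbackCochain (n : ℕ) : Cochain M n →ₗ[A] Cochain M' n where
  toFun c α' := (φ.app (Finset.univ.image α')).hom
    ((M.map (homOfLE (image_comp_eq θ α' ▸ subset_rfl))).hom (c (θ ∘ α')))
  map_add' c c' := by
    funext α'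
    change (φ.app _).hom ((M.map _).hom (c (θ ∘ α') + c' (θ ∘ α'))) =
      (φ.app _).hom ((M.map _).hom (c (θ ∘ α'))) + (φ.app _).hom ((M.map _).hom (c' (θ ∘ α')))
    rw [map_add, map_add]
  map_smul' a c := by
    funext α'
    change (φ.app _).hom ((M.map _).hom (a • c (θ ∘ α'))) = a • (φ.app _).hom ((M.map _).hom (c (θ ∘ α')))
    rw [map_smul, map_smul]

/-- Components of the pull-back. [cite: StacksProject, Tag 01FG] -/
theorem pullbackCochain_apply (n : ℕ) (c : Cochain M n) (α' : Fin (n + 1) → ι') :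
    pullbackCochain θ φ n c α' = (φ.app (Finset.univ.image α')).hom
      ((M.map (homOfLE (image_comp_eq θ α' ▸ subset_rfl))).hom (c (θ ∘ α'))) := rfl

/-- **The pull-back is a morphism of cosimplicial modules** (precomposition with `θ` commutes with every reindexing of
positions), hence a cochain map of full complexes (`pullback`). [cite: StacksProject, Tag 01FG] -/
def pullbackNatTrans : cosimplicial M ⟶ cosimplicial M' where
  app Δ := ModuleCat.ofHom (pullbackCochain θ φ Δ.len)
  naturality {Δ₁ Δ₂} f := by
    ext c
    funext α'
    change pullbackCochain θ φ _ (cosimplicialMap M f.toOrderHom c) α' =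
      cosimplicialMap M' f.toOrderHom (pullbackCochain θ φ _ c) α'
    rw [pullbackCochain_apply, cosimplicialMap_apply, cosimplicialMap_apply, pullbackCochain_apply,
      ← ModuleCat.comp_apply, ← M.map_comp]
    -- naturality of `φ` along `{α' ∘ f} ⊆ {α'}`
    have hnat := φ.naturality (homOfLE (image_comp_subset α' f.toOrderHom))
    have h1 : (M'.map (homOfLE (image_comp_subset α' ⇑f.toOrderHom))).hom
        ((φ.app (Finset.univ.image (α' ∘ ⇑f.toOrderHom))).hom
          ((M.map (homOfLE (image_comp_eq θ (α' ∘ ⇑f.toOrderHom) ▸ subset_rfl))).hom (c (θ ∘ α' ∘ ⇑f.toOrderHom)))) =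
        (φ.app (Finset.univ.image (α' ∘ ⇑f.toOrderHom)) ≫ M'.map (homOfLE (image_comp_subset α' ⇑f.toOrderHom))).hom
          ((M.map (homOfLE (image_comp_eq θ (α' ∘ ⇑f.toOrderHom) ▸ subset_rfl))).hom (c (θ ∘ α' ∘ ⇑f.toOrderHom))) := rfl
    rw [h1, ← hnat]
    change _ = (φ.app (Finset.univ.image α')).hom ((M.map ((imageFunctor θ).map _)).hom
      ((M.map (homOfLE _)).hom (c (θ ∘ α' ∘ ⇑f.toOrderHom))))
    rw [← ModuleCat.comp_apply (M.map _) (M.map _), ← M.map_comp]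
    rfl

/-- **The pull-back cochain map of full complexes along an arbitrary map of index sets.**
[cite: StacksProject, Tag 01FG] -/
def pullback : complex M ⟶ complex M' :=
  AlgebraicTopology.AlternatingCofaceMapComplex.map (pullbackNatTrans θ φ)

/-- Components of the pull-back cochain map. [cite: StacksProject, Tag 01FG] -/
theorem pullback_f (n : ℕ) : (pullback θ φ).f n = ModuleCat.ofHom (pullbackCochain θ φ n) := rfl

end Pullback

/-! ## §3 The cup product by position -/

section Cup

variable {M} {N P : Finset ι ⥤ ModuleCat.{v} A} (β : ∀ s : Finset ι, M.obj s →ₗ[A] N.obj s →ₗ[A] P.obj s)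

/-- The FRONT `p`-face of an `n`-tuple (`p + q = n`): its first `p+1` entries. [cite: StacksProject, Tag 01FP] -/
def front (p q n : ℕ) (h : p + q = n) (α : Fin (n + 1) → ι) : Fin (p + 1) → ι := α ∘ Fin.castLE (by omega)

/-- The BACK `q`-face of an `n`-tuple (`p + q = n`): its last `q+1` entries (positions `p, …, n`). [cite: StacksProject, Tag 01FP] -/
def back (p q n : ℕ) (h : p + q = n) (α : Fin (n + 1) → ι) : Fin (q + 1) → ι :=
  α ∘ Fin.cast (by omega) ∘ Fin.natAdd p

omit [LinearOrder ι] in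
/-- Entries of the front face. [cite: StacksProject, Tag 01FP] -/
@[simp] theorem front_apply (p q n : ℕ) (h : p + q = n) (α : Fin (n + 1) → ι) (i : Fin (p + 1)) :
    front p q n h α i = α ⟨i, by omega⟩ := rfl

omit [LinearOrder ι] in
/-- Entries of the back face. [cite: StacksProject, Tag 01FP] -/
@[simp] theorem back_apply (p q n : ℕ) (h : p + q = n) (α : Fin (n + 1) → ι) (i : Fin (q + 1)) :
    back p q n h α i = α ⟨p + i, by omega⟩ := rfl

/-- The front face has smaller image. [cite: StacksProject, Tag 01FP] -/
theorem image_front_subset (p q n : ℕ) (h : p + q = n) (α : Fin (n + 1) → ι) :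
    Finset.univ.image (front p q n h α) ⊆ Finset.univ.image α := image_comp_subset α _

/-- The back face has smaller image. [cite: StacksProject, Tag 01FP] -/
theorem image_back_subset (p q n : ℕ) (h : p + q = n) (α : Fin (n + 1) → ι) :
    Finset.univ.image (back p q n h α) ⊆ Finset.univ.image α := image_comp_subset α _

/-- The cup product by position as a function. [cite: StacksProject, Tag 01FP] -/
def cupFun (p q n : ℕ) (h : p + q = n) (x : Cochain M p) (y : Cochain N q) : Cochain P n := fun α =>
  β (Finset.univ.image α) ((M.map (homOfLE (image_front_subset p q n h α))).hom (x (front p q n h α)))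
    ((N.map (homOfLE (image_back_subset p q n h α))).hom (y (back p q n h α)))

/-- **The cup product BY POSITION on full cochains** along a pairing of systems `β` (`p + q = n`):
`(x ∪ y)(α₀,…,α_n) = β_{ {α} } (x(α₀,…,α_p)|, y(α_p,…,α_n)|)` — the Alexander–Whitney ∕ Čech formula, which needs NO
order on the index set. [cite: StacksProject, Tag 01FP] [cite: GortzWedhorn2023, (21.29)] -/
def cup (p q n : ℕ) (h : p + q = n) : Cochain M p →ₗ[A] Cochain N q →ₗ[A] Cochain P n :=
  LinearMap.mk₂ A (cupFun β p q n h)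
    (fun x x' y => by
      funext α
      change β _ ((M.map _).hom (x (front p q n h α) + x' (front p q n h α))) _ =
        cupFun β p q n h x y α + cupFun β p q n h x' y α
      rw [map_add, LinearMap.map_add₂]; rfl)
    (fun a x y => by
      funext α
      change β _ ((M.map _).hom (a • x (front p q n h α))) _ = a • cupFun β p q n h x y α
      rw [map_smul, LinearMap.map_smul₂]; rfl)
    (fun x y y' => by
      funext α
      change β _ _ ((N.map _).hom (y (back p q n h α) + y' (back p q n h α))) =
        cupFun β p q n h x y α + cupFun β p q n h x y' α
      rw [map_add, map_add]; rfl)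
    (fun a x y => by
      funext α
      change β _ _ ((N.map _).hom (a • y (back p q n h α))) = a • cupFun β p q n h x y α
      rw [map_smul, map_smul]; rfl)

/-- Components of the cup product. [cite: StacksProject, Tag 01FP] -/
theorem cup_apply (p q n : ℕ) (h : p + q = n) (x : Cochain M p) (y : Cochain N q) (α : Fin (n + 1) → ι) :
    cup β p q n h x y α = β (Finset.univ.image α)
      ((M.map (homOfLE (image_front_subset p q n h α))).hom (x (front p q n h α)))
      ((N.map (homOfLE (image_back_subset p q n h α))).hom (y (back p q n h α))) := rfl

end Cup

/-! ## §4 Restriction to the ordered complex and the alternating extension -/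

section ResExt

variable {M}

/-- An `n`-simplex has `n + 1` elements (natural-number form). [cite: StacksProject, Tag 01FG] -/
theorem card_simplex (n : ℕ) (σ : Simplex ι n) : σ.1.card = n + 1 := by
  have := σ.2.2; omega

/-- The sorted enumeration of a simplex has the simplex as image. [cite: StacksProject, Tag 01FG] -/
theorem image_orderEmbOfFin_simplex (n : ℕ) (σ : Simplex ι n) :
    Finset.univ.image ⇑(σ.1.orderEmbOfFin (card_simplex n σ)) = σ.1 :=
  Finset.image_orderEmbOfFin_univ σ.1 _

variable (M)

/-- **Restriction of a full cochain to the ordered complex**: keep the components at strictly increasing tuples,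
`(res c)_σ = c(e_σ)` for the sorted enumeration `e_σ` of `σ`. [cite: StacksProject, Tag 01FG] -/
def res (n : ℕ) : Cochain M n →ₗ[A] SysCochain M n where
  toFun c σ := (M.map (homOfLE (image_orderEmbOfFin_simplex n σ).le)).hom (c ⇑(σ.1.orderEmbOfFin (card_simplex n σ)))
  map_add' c c' := by funext σ; exact map_add _ _ _
  map_smul' a c := by funext σ; exact map_smul _ _ _

/-- Components of the restriction. [cite: StacksProject, Tag 01FG] -/
theorem res_apply (n : ℕ) (c : Cochain M n) (σ : Simplex ι n) :
    res M n c σ = (M.map (homOfLE (image_orderEmbOfFin_simplex n σ).le)).hom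
      (c ⇑(σ.1.orderEmbOfFin (card_simplex n σ))) := rfl

/-- **The alternating extension of an ordered cochain to a full cochain**: `(ext g)(α) = g.altEvalAt α {α}` — the signed
value `(-1)^{inv α} g_{ {α} }`, `0` on tuples with a repeated index. [cite: StacksProject, Tag 01FG] -/
def ext (n : ℕ) : SysCochain M n →ₗ[A] Cochain M n where
  toFun g α := g.altEvalAt α (Finset.univ.image α)
  map_add' g g' := by funext α; exact SysCochain.altEvalAt_add g g' α _
  map_smul' a g := by funext α; exact SysCochain.altEvalAt_smul a g α _

/-- Components of the extension. [cite: StacksProject, Tag 01FG] -/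
theorem ext_apply (n : ℕ) (g : SysCochain M n) (α : Fin (n + 1) → ι) :
    ext M n g α = g.altEvalAt α (Finset.univ.image α) := rfl

end ResExt

end Full

end OrderedCech

end Literature.Algebra.Homology

end
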